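import Literature.AnabelianGeometry.EtaleTheta.RealificationFunctorWeak
import Literature.AnabelianGeometry.EtaleTheta.Discharge.Sec3Lemma35HoldsWeak
import HarnessLib

/-!
# The weak realification functor SUBSUMES the printed one: `rlfFunctorWeak Φ _ = rlfFunctor Φ hΦ` for
# perf-factorial values ([FrdI] Prop. 5.3; [EtTh] Def. 3.6 (i))

Sources: S. Mochizuki, *The geometry of Frobenioids I* [MochizukiFrdI2008], Def. 2.4 (i) p. 48, Prop. 5.3
p. 103; S. Mochizuki, *The étale theta function …* [MochizukiEtTh2009], Def. 3.6 (i) p. 76.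

Proof-only (theorems only).  For a monoid-valued functor `Φ` whose values are perf-factorial AS PRINTED
(`hΦ`), the values are also weakly perf-factorial with cofinal perfection
(`isPerfFactorialCof_of_isPerfFactorial`, abc-iut-L2-d2), the weak realification `(h.weak).Rlf` IS the
printed one (`h.weak.realification = h.realification` by `rfl`, `RealificationOrderWeak.lean`), and the two
constructions of the realification functor — abc-iut-L2-d2's `rlfFunctor Φ hΦ` (`RealificationFunctor.lean`,
strong universal property) and abc-iut-L6-t12's `rlfFunctorWeak Φ _` (`RealificationFunctorWeak.lean`, weak
universal property) — AGREE: the transition maps are both "the" homomorphism over `Φ(f)^pf`, unique by the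
universal property (`rlfMapWeak_eq_rlfMap`), hence `rlfFunctorWeak_eq_rlfFunctor` (equality of functors with
definitionally equal object parts) and `toRlfNatTransWeak_app_apply` (the natural maps `Φ → Φ^rlf` agree
pointwise).  So every statement proved over the weak chain specialises to the printed one, and the weak
files of the F-L2d2-1 / F-L2d2-2 repair chain lose nothing where Prop. 3.4 (i) holds as printed.
Seat abc-iut-L6-t12 (cell abc-iut; piece (B′)).  HONEST FRAMING: classical monoid algebra; nothing here
bears on [IUTchIII] Cor. 3.12.
-/

namespace Literature.AnabelianGeometry.EtaleTheta

open CategoryTheory Literature.AlgebraicGeometry.Frobenioids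

universe w v u

section Compat

variable {J : Type u} [Category.{v} J] (Φ : J ⥤ CommMonCat.{w})

/-- Perf-factorial values are weakly perf-factorial with cofinal perfection (the hypothesis of the weak
functor, from the printed one). [cite: MochizukiFrdI2008, Def. 2.4(i) p.47] -/
theorem isPerfFactorialCof_of_forall (hΦ : ∀ j : J, IsPerfFactorial (Φ.obj j)) (j : J) :
    IsPerfFactorialCof (Φ.obj j) :=
  isPerfFactorialCof_of_isPerfFactorial (hΦ j)

/-- **The weak transition maps are the printed ones**: for perf-factorial values, `rlfMapWeak Φ _ f =
rlfMap Φ hΦ f` (both are the unique homomorphism `Φ(j)^rlf → Φ(j')^rlf` over `Φ(f)^pf`; the weak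
realification of a perf-factorial monoid is the printed one, definitionally).
[cite: MochizukiFrdI2008, Prop. 5.3 p.103] -/
theorem rlfMapWeak_eq_rlfMap (hΦ : ∀ j : J, IsPerfFactorial (Φ.obj j)) {j j' : J} (f : j ⟶ j') :
    rlfMapWeak Φ (isPerfFactorialCof_of_forall Φ hΦ) f = rlfMap Φ hΦ f :=
  (RlfUniversal.existsUnique_map (hΦ j) (hΦ j') (hΦ j').supports_rlf_R (Φ.map f).hom).unique
    (rlfMapWeak_comp_toRealification Φ (isPerfFactorialCof_of_forall Φ hΦ) f)
    (rlfMap_comp_toRealification Φ hΦ f)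

/-- **The weak realification functor of a functor with perf-factorial values IS the printed realification
functor** (`rlfFunctorWeak Φ _ = rlfFunctor Φ hΦ`: same objects `Φ(j)^rlf`, same maps).
[cite: MochizukiFrdI2008, Prop. 5.3 p.103] -/
theorem rlfFunctorWeak_eq_rlfFunctor (hΦ : ∀ j : J, IsPerfFactorial (Φ.obj j)) :
    rlfFunctorWeak Φ (isPerfFactorialCof_of_forall Φ hΦ) = rlfFunctor Φ hΦ := by
  refine CategoryTheory.Functor.hext (fun _ => rfl) (fun j j' f => ?_)
  apply heq_of_eq
  apply CommMonCat.hom_ext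
  exact rlfMapWeak_eq_rlfMap Φ hΦ f

/-- The natural maps `Φ(j) → Φ(j)^rlf` of the two constructions agree pointwise.
[cite: MochizukiEtTh2009, Def 3.6 p.76] -/
theorem toRlfNatTransWeak_app_apply (hΦ : ∀ j : J, IsPerfFactorial (Φ.obj j)) (j : J) (a : Φ.obj j) :
    ((toRlfNatTransWeak Φ (isPerfFactorialCof_of_forall Φ hΦ)).app j).hom a =
      (((toRlfNatTrans Φ hΦ).app j).hom a : (hΦ j).Rlf) :=
  rfl

end Compat

end Literature.AnabelianGeometry.EtaleTheta
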